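import Summits.Parity.GeneralizedHardyLittlewood.Theses.GreenTaoLevelTwo
import Literature.NumberTheory.Sieve.MoebiusQuadraticMinorArc
import Literature.NumberTheory.Sieve.MoebiusExpSumUniform
import HarnessLib

/-!
# `HuaQuadraticRung` (route `GreenTaoLevelTwo`, item stmt-Parity-21367): Hua's estimate

`Summit.Parity.GeneralizedHardyLittlewood.Theses.GreenTaoLevelTwo.HuaQuadraticRung`:
for every `A > 0` there is `C` (ineffective, through Siegel's theorem) with
`‖∑_{n ≤ N} μ(n) e(αn² + βn)‖ ≤ C N / (log N)^A` for all `N ≥ 2`, uniformly in `α, β ∈ ℝ`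
(L.-K. Hua 1938; the model case of B. Green, T. Tao, *Quadratic uniformity of the Möbius
function*, Ann. Inst. Fourier 58 (2008), Thm 1.1, and of `MNTwo`). A FORMALISATION RUNG
(frontier ledger F-GT2 via `MNTwo`'s registered stub `stub_rung_huaQuadratic`); it makes no claim
about Goldbach or the summit `GeneralizedHardyLittlewood`.

Proof (Green–Tao AIF §7, over tree inputs, all PROVED):
* minor arcs — `Literature.NumberTheory.Sieve.QuadraticMoebius.exists_denominator_of_large_quadratic_moebius_sum`
  (if the sum is `≥ δN` then `‖qα‖ ≤ C₀((1+log N)/δ)^{A₀}/N²` for some `q ≤ C₀((1+log N)/δ)^{A₀}`;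
  Vaughan's identity, the type I/II inverse theorem, the quadratic Weyl inequality, and
  "recurrent square phases are major arc"), applied with `δ = (1 + log N)^{-A}`;
* major arcs — `Literature.NumberTheory.Sieve.MoebiusExpSum.norm_sum_moebius_quadratic_le_of_near_rat`
  (`‖∑ μ(n)e(αn²+βn)‖ ≤ C q (1 + N²|α − a/q|) N (log N)^{-A'}`; Davenport's theorem from
  Siegel–Walfisz, residue classes mod `q`, Abel summation), with `A' = A + 2A₀(A+1)`.
-/

noncomputable section

open Finset Real
open scoped FourierTransform ArithmeticFunction.Moebius

namespace Summit.Parity.GeneralizedHardyLittlewood.Theorems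

open Literature.NumberTheory.Sieve.Vinogradov (distInt)

/-- `exp(2πi x) = e(x)` (Mathlib's `𝐞`, coerced to `ℂ`). [folklore] -/
private theorem exp_two_pi_mul_I_eq_fourierChar (x : ℝ) :
    Complex.exp (2 * Real.pi * Complex.I * (x : ℂ)) = (𝐞 x : ℂ) := by
  rw [Real.fourierChar_apply]
  congr 1
  push_cast
  ring

/-- **Hua's estimate** `∑_{n ≤ N} μ(n) e(αn² + βn) ≪_A N (log N)^{-A}`, uniformly in `α, β`:
the route decl `HuaQuadraticRung` of `GreenTaoLevelTwo` (item stmt-Parity-21367). Minor arcs by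
`QuadraticMoebius.exists_denominator_of_large_quadratic_moebius_sum` with `δ = (1 + log N)^{-A}`,
major arcs by `MoebiusExpSum.norm_sum_moebius_quadratic_le_of_near_rat`. A formalisation rung;
no claim about Goldbach. -/
theorem huaQuadraticRung_proof :
    Summit.Parity.GeneralizedHardyLittlewood.Theses.GreenTaoLevelTwo.HuaQuadraticRung := by
  unfold Summit.Parity.GeneralizedHardyLittlewood.Theses.GreenTaoLevelTwo.HuaQuadraticRung
  intro A hA
  obtain ⟨A₀, C₀, hC₀, hMin⟩ :=
    Literature.NumberTheory.Sieve.QuadraticMoebius.exists_denominator_of_large_quadratic_moebius_sum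
  -- exponent of the major-arc input
  set e : ℝ := 2 * ((1 + A) * A₀) with he
  have he0 : 0 ≤ e := by rw [he]; positivity
  obtain ⟨CM, hCM, hMaj⟩ :=
    Literature.NumberTheory.Sieve.MoebiusExpSum.norm_sum_moebius_quadratic_le_of_near_rat (e + A)
      (by positivity)
  refine ⟨max 1 (2 * CM * C₀ ^ 2 * 3 ^ e), fun N hN α β => ?_⟩
  have hN0 : (0 : ℝ) < N := by exact_mod_cast (lt_of_lt_of_le (by norm_num) hN)
  set L : ℝ := Real.log N with hL
  have hL2 : 1 / 2 < L := Literature.NumberTheory.Sieve.Vinogradov.half_lt_log hN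
  have hL0 : 0 < L := by linarith
  have hLA : 0 < L ^ A := Real.rpow_pos_of_pos hL0 A
  have h1L : 0 < 1 + L := by linarith
  have h1L3 : 1 + L ≤ 3 * L := by linarith
  -- rewrite the sum with `𝐞`
  have hsum : ∑ n ∈ Icc 1 N, ((ArithmeticFunction.moebius n : ℝ) : ℂ) *
      Complex.exp (2 * Real.pi * Complex.I * ((α * (n : ℝ) ^ 2 + β * n : ℝ) : ℂ)) =
      ∑ n ∈ Icc 1 N, ((μ n : ℝ) : ℂ) * (𝐞 (α * (n : ℝ) ^ 2 + β * n) : ℂ) :=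
    Finset.sum_congr rfl fun n _ => by rw [exp_two_pi_mul_I_eq_fourierChar]
  rw [hsum]
  set S := ∑ n ∈ Icc 1 N, ((μ n : ℝ) : ℂ) * (𝐞 (α * (n : ℝ) ^ 2 + β * n) : ℂ) with hSdef
  -- `δ = (1 + L)^{-A}`
  set δ : ℝ := ((1 + L) ^ A)⁻¹ with hδdef
  have h1LA : 0 < (1 + L) ^ A := Real.rpow_pos_of_pos h1L A
  have hδ0 : 0 < δ := inv_pos.mpr h1LA
  have hδ1 : δ ≤ 1 := by
    rw [hδdef]; exact inv_le_one_of_one_le₀ (Real.one_le_rpow (by linarith) hA.le)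
  have hLA' : L ^ A ≤ (1 + L) ^ A := Real.rpow_le_rpow hL0.le (by linarith) hA.le
  by_cases hsmall : ‖S‖ < δ * N
  · -- trivially small
    have h1 : δ * N ≤ N / L ^ A := by
      rw [hδdef, inv_mul_eq_div]
      exact div_le_div_of_nonneg_left hN0.le hLA hLA'
    calc ‖S‖ ≤ N / L ^ A := hsmall.le.trans h1
      _ = 1 * N / L ^ A := by rw [one_mul]
      _ ≤ max 1 (2 * CM * C₀ ^ 2 * 3 ^ e) * N / L ^ A := by
          refine div_le_div_of_nonneg_right ?_ hLA.le
          exact mul_le_mul_of_nonneg_right (le_max_left _ _) hN0.le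
  · push Not at hsmall
    obtain ⟨q, hq1, hqle, hdist⟩ := hMin N hN δ hδ0 hδ1 α β hsmall
    -- `Q = C₀ ((1+L)/δ)^{A₀} = C₀ (1+L)^{(1+A)A₀}`
    set Q : ℝ := C₀ * ((1 + Real.log N) / δ) ^ A₀ with hQdef
    have hQ : Q = C₀ * (1 + L) ^ ((1 + A) * A₀) := by
      rw [hQdef, ← hL, hδdef, div_inv_eq_mul]
      congr 1
      rw [show (1 + L) * (1 + L) ^ A = (1 + L) ^ (1 + A) by
        rw [Real.rpow_add h1L, Real.rpow_one], ← Real.rpow_natCast, ← Real.rpow_mul h1L.le]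
    have hQ1 : 1 ≤ Q := le_trans (by exact_mod_cast hq1) hqle
    have hQ0 : 0 < Q := by linarith
    -- `|α − a/q| ≤ Q/N²` with `a = round(qα)`
    set a : ℤ := round ((q : ℝ) * α) with ha
    have hqr : (0 : ℝ) < q := by exact_mod_cast hq1
    have hnear : |α - a / q| ≤ Q / (N : ℝ) ^ 2 := by
      have h1 : |α - a / q| = distInt ((q : ℝ) * α) / q := by
        rw [Literature.NumberTheory.Sieve.Vinogradov.distInt, ← ha]
        rw [show α - (a : ℝ) / q = ((q : ℝ) * α - a) / q by field_simp]
        rw [abs_div, abs_of_pos hqr]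
      rw [h1]
      calc distInt ((q : ℝ) * α) / q ≤ distInt ((q : ℝ) * α) / 1 :=
            div_le_div_of_nonneg_left (Literature.NumberTheory.Sieve.Vinogradov.distInt_nonneg _)
              one_pos (by exact_mod_cast hq1)
        _ = distInt ((q : ℝ) * α) := div_one _
        _ ≤ Q / (N : ℝ) ^ 2 := hdist
    have hmaj := hMaj N hN q hq1 a α β
    refine hmaj.trans ?_
    -- bookkeeping: `CM q (1 + N²|α − a/q|) N / L^{e+A} ≤ 2 CM Q² N / L^{e+A} ≤ 2 CM C₀² 3^e N / L^A`
    have hN2 : (0 : ℝ) < (N : ℝ) ^ 2 := by positivity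
    have h1 : 1 + (N : ℝ) ^ 2 * |α - a / q| ≤ 2 * Q := by
      have : (N : ℝ) ^ 2 * |α - a / q| ≤ Q := by
        calc (N : ℝ) ^ 2 * |α - a / q| ≤ (N : ℝ) ^ 2 * (Q / (N : ℝ) ^ 2) :=
              mul_le_mul_of_nonneg_left hnear hN2.le
          _ = Q := by field_simp
      linarith
    have hLeA : L ^ (e + A) = L ^ e * L ^ A := Real.rpow_add hL0 e A
    have hLe0 : 0 < L ^ e := Real.rpow_pos_of_pos hL0 e
    have hQ2 : Q ^ 2 ≤ C₀ ^ 2 * (3 ^ e * L ^ e) := by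
      rw [hQ, mul_pow, ← Real.rpow_natCast ((1 + L) ^ ((1 + A) * A₀)) 2,
        ← Real.rpow_mul h1L.le]
      have hexp : (1 + A) * (A₀ : ℝ) * ((2 : ℕ) : ℝ) = e := by rw [he]; push_cast; ring
      rw [hexp, ← Real.mul_rpow (by norm_num) hL0.le]
      exact mul_le_mul_of_nonneg_left (Real.rpow_le_rpow h1L.le h1L3 he0) (by positivity)
    calc CM * q * (1 + (N : ℝ) ^ 2 * |α - a / q|) * N / L ^ (e + A)
        ≤ CM * Q * (2 * Q) * N / L ^ (e + A) := by
          refine div_le_div_of_nonneg_right ?_ (Real.rpow_pos_of_pos hL0 _).le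
          refine mul_le_mul_of_nonneg_right ?_ hN0.le
          exact mul_le_mul (mul_le_mul_of_nonneg_left hqle hCM.le) h1 (by positivity)
            (by positivity)
      _ = 2 * CM * Q ^ 2 * N / (L ^ e * L ^ A) := by rw [hLeA]; ring
      _ ≤ 2 * CM * (C₀ ^ 2 * (3 ^ e * L ^ e)) * N / (L ^ e * L ^ A) := by
          refine div_le_div_of_nonneg_right ?_ (by positivity)
          refine mul_le_mul_of_nonneg_right ?_ hN0.le
          exact mul_le_mul_of_nonneg_left hQ2 (by positivity)
      _ = 2 * CM * C₀ ^ 2 * 3 ^ e * N / L ^ A := by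
          field_simp
      _ ≤ max 1 (2 * CM * C₀ ^ 2 * 3 ^ e) * N / L ^ A := by
          refine div_le_div_of_nonneg_right ?_ hLA.le
          exact mul_le_mul_of_nonneg_right (le_max_right _ _) hN0.le

end Summit.Parity.GeneralizedHardyLittlewood.Theorems
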